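import Literature.MathematicalPhysics.QuantumFieldTheory.ConformalBootstrap3D.PointKernelK34v2Data
import Literature.MathematicalPhysics.QuantumFieldTheory.ConformalBootstrap3D.PointKernelParts

/-!
# K34v2 certificate, kernel part file P16: one-cell head segments 139, 140 in level ranges

The head cells whose kernel evaluation exceeds one `decide` are one-cell segments of `hsegsK34v2`; each is
checked by `PCert.hPartSideOK` (side conditions) and `PCert.hPartOK` per level range `[n_lo, n_lo + count)`
against an integer claim, the claims summing to `≥ 0` (`PointKernel.partsOK`); soundness is
`PCert.hParts_sound` (`PointKernelParts`).  The part files `P1, P2, …` are mutually independent (each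
imports only the data file); the ranges of one cell may span several of them, and the per-cell
conclusions `hparts_i` / `hcell_i` of those cells are assembled in `PointKernelK34v2.lean`.
Estimated kernel time 241 s.
-/

set_option maxRecDepth 100000
set_option maxHeartbeats 0

namespace Literature.MathematicalPhysics.QuantumFieldTheory.ConformalBootstrap3D.PointKernelK34v2

open Literature.MathematicalPhysics.QuantumFieldTheory.ConformalBootstrap3D.PointKernel

/-- levels `[60, 64)` of segment 139: partial lower sum `≥` claim. [folklore] -/
theorem part_139_6 : certK34v2.hPartOK (PCert.segAt hsegsK34v2 139) JHK34v2 60 4 (419322431147157045196869440658551928) = true := by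
  decide +kernel

/-- levels `[64, 68)` of segment 139: partial lower sum `≥` claim. [folklore] -/
theorem part_139_7 : certK34v2.hPartOK (PCert.segAt hsegsK34v2 139) JHK34v2 64 4 (266169398211169834247329785443169976) = true := by
  decide +kernel

/-- levels `[68, 71)` of segment 139: partial lower sum `≥` claim. [folklore] -/
theorem part_139_8 : certK34v2.hPartOK (PCert.segAt hsegsK34v2 139) JHK34v2 68 3 (131818278826076264115671867414797804) = true := by
  decide +kernel

/-- levels `[71, 73)` of segment 139: partial lower sum `≥` claim. [folklore] -/
theorem part_139_9 : certK34v2.hPartOK (PCert.segAt hsegsK34v2 139) JHK34v2 71 2 (63685752265942878827642099597854885) = true := by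
  decide +kernel

/-- one-cell segment 140 (row 6, cell `[28673/4096, 14337/2048]`, chord, `n_F = 72`,
10 level ranges): side conditions. [folklore] -/
theorem pside_140 : certK34v2.hPartSideOK (PCert.segAt hsegsK34v2 140) JHK34v2 = true := by
  decide +kernel

/-- its level ranges `(n_lo, count, claim)`. [folklore] -/
def parts_140 : List (ℕ × ℕ × ℤ) := [(0, 25, -43272349221227890164923647966207069025), (25, 11, 27498972883947354805209242108179288103), (36, 8, 9208919226319908629063254664420673511), (44, 6, 3327796796162027176223333133534059397), (50, 5, 1515671782353637632364012417977144195), (55, 5, 867848499263374848583882344958940632), (60, 4, 412390387258070876012703354085244575), (64, 4, 259212957974356183910045189804137156), (68, 3, 124840148866074663729363029252520253), (71, 2, 56696539083085349827811723995061207)]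

/-- the ranges tile `[0, n_F]` and the claims sum to `≥ 0`. [folklore] -/
theorem pcov_140 : PointKernel.partsOK 72 parts_140 = true := by
  decide +kernel

end Literature.MathematicalPhysics.QuantumFieldTheory.ConformalBootstrap3D.PointKernelK34v2
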